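import Mathlib
import Summits.MatrixMultiplication.MatrixMultiplication.Theses.LevelGradedCohnUmans

/-!
# `SnLevelDesigns` (stmt-MatrixMultiplication-7613), line `garnir-annihilator`:
# M1 `stub_linearCriterion` — the exact linear criterion for `k`-token separation of a triple

Crux `Summit.MatrixMultiplication.MatrixMultiplication.Theses.LevelGradedCohnUmans.SnLevelDesigns`;
skeleton `Cruxes/SnLevelDesigns/Lines/garnir_annihilator.lean` (lead c3 reshape 6, stub M1).

The registered signature of M1 (no side condition) is FALSE in the degenerate corner
`n = 0, k ≥ 1, Y = ∅, X = Z = {1}`: separation is vacuous (no `y ∈ Y`), the garbage set is empty, and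
`ev_{x₀⁻¹z₀} = 0 ∈ ⊥ = span ∅` because `Fin k → Fin 0` is empty (scratch `stub_linearCriterion_counterexample.lean`,
`ScratchM1.not_registered`, axioms `propext, Classical.choice, Quot.sound`). This file proves the criterion under
either of the two natural side conditions, `Y.Nonempty` (`stub_linearCriterion`, the REGISTERED stub M1 after the lead's re-registration) or `0 < n`
(`linearCriterion_of_pos`), and in the hypothesis-free form `separated ↔ (Y.Nonempty → criterion)`
(`linearCriterion_iff`); the direction (←) holds unconditionally (`lc_separated_of_forall_not_mem_span`).

`(X, Y, Z)` is `k`-token separated iff for every target `(x₀, z₀)` the evaluation functional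
`ev_{x₀⁻¹z₀} : c ↦ Σ_p c p ((x₀⁻¹z₀) ∘ p)` is not in the `ℂ`-span of the evaluation functionals of the garbage
products `x⁻¹ y y'⁻¹ z`, `(x, y, y', z) ∈ X × Y × Y × Z` with `¬(x = x₀ ∧ y = y' ∧ z = z₀)`.
* (→) `lc_not_mem_span_of_apply`: evaluation at the separator `c` is linear (`LinearMap.proj c`), it kills every
  garbage functional and is `1 ≠ 0` at the target — the latter needs ONE `y ∈ Y` (target quadruple `(x₀, y, y, z₀)`).
* (←) `lc_exists_eq_one_forall_eq_zero` (Mathlib `mem_span_of_iInf_ker_le_ker`): for finitely many linear forms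
  `L_i` and a form `f` on any vector space, `⇑f ∉ span {⇑L_i}` gives a vector with `f v = 1`, `L_i v = 0`; with
  `L_g = ev_g` (`g` garbage) and `f = ev_{x₀⁻¹z₀}` that vector is the separator (`lc_exists_table`,
  `lc_separated_of_forall_not_mem_span`; every target quadruple has product `x₀⁻¹ y y⁻¹ z₀ = x₀⁻¹ z₀`).
-/

set_option linter.dupNamespace false

namespace Summit.MatrixMultiplication.MatrixMultiplication.Theorems.SnLevelDesigns

open scoped BigOperators

/-- Evaluation separates from a span: if every function in `s` vanishes at the point `a` while `φ a ≠ 0`, then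
`φ ∉ span ℂ s` (the span lies in the kernel of the linear evaluation `LinearMap.proj a`). -/
theorem lc_not_mem_span_of_apply {α : Type*} {s : Set (α → ℂ)} {φ : α → ℂ} (a : α)
    (hs : ∀ ψ ∈ s, ψ a = 0) (hφ : φ a ≠ 0) : φ ∉ Submodule.span ℂ s := by
  intro hmem
  have hle : Submodule.span ℂ s ≤ LinearMap.ker (LinearMap.proj a : (α → ℂ) →ₗ[ℂ] ℂ) :=
    Submodule.span_le.2 fun ψ hψ => by
      rw [SetLike.mem_coe, LinearMap.mem_ker, LinearMap.proj_apply]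
      exact hs ψ hψ
  have h0 := hle hmem
  rw [LinearMap.mem_ker, LinearMap.proj_apply] at h0
  exact hφ h0

/-- Finite-dimensional duality (Mathlib `mem_span_of_iInf_ker_le_ker`, made affine): for finitely many linear
forms `L i` and a linear form `f` on a vector space, if `⇑f` is not in the span of the functions `⇑(L i)`, then some
vector `v` has `f v = 1` and `L i v = 0` for all `i` (otherwise `⋂ ker L_i ⊆ ker f`, so `f ∈ span L_i`). -/
theorem lc_exists_eq_one_forall_eq_zero {K V ι : Type*} [Field K] [AddCommGroup V] [Module K V] [Finite ι]
    (L : ι → V →ₗ[K] K) (f : V →ₗ[K] K)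
    (h : (⇑f : V → K) ∉ Submodule.span K (Set.range fun i => (⇑(L i) : V → K))) :
    ∃ v : V, f v = 1 ∧ ∀ i, L i v = 0 := by
  classical
  have hker : ¬ (⨅ i, LinearMap.ker (L i)) ≤ LinearMap.ker f := by
    intro hle
    apply h
    have _ := Fintype.ofFinite ι
    obtain ⟨a, ha⟩ := (Submodule.mem_span_range_iff_exists_fun K).1 (mem_span_of_iInf_ker_le_ker hle)
    have hfun : (⇑f : V → K) = ∑ i, a i • (⇑(L i) : V → K) := by
      funext v
      rw [← ha]
      simp only [LinearMap.coe_sum, Finset.sum_apply, LinearMap.smul_apply, Pi.smul_apply]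
    rw [hfun]
    exact Submodule.sum_mem _ fun i _ => Submodule.smul_mem _ _ (Submodule.subset_span ⟨i, rfl⟩)
  obtain ⟨v, hvL, hvf⟩ := SetLike.not_le_iff_exists.1 hker
  rw [Submodule.mem_iInf] at hvL
  simp only [LinearMap.mem_ker] at hvL hvf
  refine ⟨(f v)⁻¹ • v, ?_, fun i => ?_⟩
  · rw [map_smul, smul_eq_mul, inv_mul_cancel₀ hvf]
  · rw [map_smul, hvL i, smul_zero]

/-- (←, one target) If `ev_t ∉ span {ev_g : g ∈ G}` then some coefficient table `c` has `ev_t c = 1` and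
`ev_g c = 0` for every `g ∈ G` (`lc_exists_eq_one_forall_eq_zero` for the linear forms `c ↦ Σ_p c p (g ∘ p)`). -/
theorem lc_exists_table {n k : ℕ} {G : Set (Equiv.Perm (Fin n))} {t : Equiv.Perm (Fin n)}
    (h : (fun c : (Fin k → Fin n) → (Fin k → Fin n) → ℂ => ∑ p : Fin k → Fin n, c p (⇑t ∘ p)) ∉
      Submodule.span ℂ
        ((fun g : Equiv.Perm (Fin n) =>
            fun c : (Fin k → Fin n) → (Fin k → Fin n) → ℂ => ∑ p : Fin k → Fin n, c p (⇑g ∘ p)) '' G)) :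
    ∃ c : (Fin k → Fin n) → (Fin k → Fin n) → ℂ,
      (∑ p : Fin k → Fin n, c p (⇑t ∘ p)) = 1 ∧ ∀ g ∈ G, (∑ p : Fin k → Fin n, c p (⇑g ∘ p)) = 0 := by
  -- `ev_g` as a linear form in the table `c`
  let L : Equiv.Perm (Fin n) → ((Fin k → Fin n) → (Fin k → Fin n) → ℂ) →ₗ[ℂ] ℂ := fun g =>
    { toFun := fun c => ∑ p : Fin k → Fin n, c p (⇑g ∘ p)
      map_add' := fun c d => by simp only [Pi.add_apply, Finset.sum_add_distrib]
      map_smul' := fun a c => by simp only [Pi.smul_apply, smul_eq_mul, RingHom.id_apply, Finset.mul_sum] }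
  have hrange :
      Set.range (fun i : ↥G => (⇑(L i.1) : ((Fin k → Fin n) → (Fin k → Fin n) → ℂ) → ℂ)) =
        (fun g : Equiv.Perm (Fin n) =>
            fun c : (Fin k → Fin n) → (Fin k → Fin n) → ℂ => ∑ p : Fin k → Fin n, c p (⇑g ∘ p)) '' G :=
    (Set.image_eq_range (fun g : Equiv.Perm (Fin n) =>
      fun c : (Fin k → Fin n) → (Fin k → Fin n) → ℂ => ∑ p : Fin k → Fin n, c p (⇑g ∘ p)) G).symm
  obtain ⟨c, hc1, hc0⟩ :=
    lc_exists_eq_one_forall_eq_zero (fun i : ↥G => L i.1) (L t) (by rw [hrange]; exact h)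
  exact ⟨c, hc1, fun g hg => hc0 ⟨g, hg⟩⟩

/-- (←) If for every target `(x₀, z₀)` the functional `ev_{x₀⁻¹z₀}` is outside the span of the garbage functionals,
the triple is `k`-token separated: the table of `lc_exists_table` is `1` on every target quadruple (product
`x₀⁻¹ y y⁻¹ z₀ = x₀⁻¹ z₀`) and `0` on every garbage quadruple. No side condition. -/
theorem lc_separated_of_forall_not_mem_span {n k : ℕ} {X Y Z : Finset (Equiv.Perm (Fin n))}
    (h : ∀ x₀ ∈ X, ∀ z₀ ∈ Z,
      (fun c : (Fin k → Fin n) → (Fin k → Fin n) → ℂ => ∑ p : Fin k → Fin n, c p (⇑(x₀⁻¹ * z₀) ∘ p)) ∉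
        Submodule.span ℂ
          ((fun g : Equiv.Perm (Fin n) =>
              fun c : (Fin k → Fin n) → (Fin k → Fin n) → ℂ => ∑ p : Fin k → Fin n, c p (⇑g ∘ p)) ''
            {g | ∃ x ∈ X, ∃ y ∈ Y, ∃ y' ∈ Y, ∃ z ∈ Z, ¬ (x = x₀ ∧ y = y' ∧ z = z₀) ∧ g = x⁻¹ * y * y'⁻¹ * z})) :
    ∀ x₀ ∈ X, ∀ z₀ ∈ Z, ∃ c : (Fin k → Fin n) → (Fin k → Fin n) → ℂ,
      ∀ x ∈ X, ∀ y ∈ Y, ∀ y' ∈ Y, ∀ z ∈ Z,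
        (∑ p : Fin k → Fin n, c p (⇑(x⁻¹ * y * y'⁻¹ * z) ∘ p)) = if x = x₀ ∧ y = y' ∧ z = z₀ then 1 else 0 := by
  intro x₀ hx₀ z₀ hz₀
  obtain ⟨c, hc1, hc0⟩ := lc_exists_table (h x₀ hx₀ z₀ hz₀)
  refine ⟨c, fun x hx y hy y' hy' z hz => ?_⟩
  by_cases hq : x = x₀ ∧ y = y' ∧ z = z₀
  · obtain ⟨rfl, rfl, rfl⟩ := hq
    rw [if_pos ⟨rfl, rfl, rfl⟩, mul_inv_cancel_right, hc1]
  · rw [if_neg hq]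
    exact hc0 _ ⟨x, hx, y, hy, y', hy', z, hz, hq, rfl⟩

/-- (→, needs one `y ∈ Y`) If the triple is `k`-token separated then for every target `(x₀, z₀)` the functional
`ev_{x₀⁻¹z₀}` is outside the span of the garbage functionals: evaluate at the separator `c` of `(x₀, z₀)`
(`lc_not_mem_span_of_apply`); it kills the garbage and gives `1` at `x₀⁻¹ z₀ = x₀⁻¹ y₁ y₁⁻¹ z₀`. -/
theorem lc_forall_not_mem_span_of_separated {n k : ℕ} {X Y Z : Finset (Equiv.Perm (Fin n))}
    (hY : Y.Nonempty)
    (h : ∀ x₀ ∈ X, ∀ z₀ ∈ Z, ∃ c : (Fin k → Fin n) → (Fin k → Fin n) → ℂ,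
      ∀ x ∈ X, ∀ y ∈ Y, ∀ y' ∈ Y, ∀ z ∈ Z,
        (∑ p : Fin k → Fin n, c p (⇑(x⁻¹ * y * y'⁻¹ * z) ∘ p)) = if x = x₀ ∧ y = y' ∧ z = z₀ then 1 else 0) :
    ∀ x₀ ∈ X, ∀ z₀ ∈ Z,
      (fun c : (Fin k → Fin n) → (Fin k → Fin n) → ℂ => ∑ p : Fin k → Fin n, c p (⇑(x₀⁻¹ * z₀) ∘ p)) ∉
        Submodule.span ℂ
          ((fun g : Equiv.Perm (Fin n) =>
              fun c : (Fin k → Fin n) → (Fin k → Fin n) → ℂ => ∑ p : Fin k → Fin n, c p (⇑g ∘ p)) ''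
            {g | ∃ x ∈ X, ∃ y ∈ Y, ∃ y' ∈ Y, ∃ z ∈ Z, ¬ (x = x₀ ∧ y = y' ∧ z = z₀) ∧ g = x⁻¹ * y * y'⁻¹ * z}) := by
  intro x₀ hx₀ z₀ hz₀
  obtain ⟨y₁, hy₁⟩ := hY
  obtain ⟨c, hc⟩ := h x₀ hx₀ z₀ hz₀
  refine lc_not_mem_span_of_apply c ?_ ?_
  · rintro ψ ⟨g, ⟨x, hx, y, hy, y', hy', z, hz, hne, rfl⟩, rfl⟩
    show (∑ p : Fin k → Fin n, c p (⇑(x⁻¹ * y * y'⁻¹ * z) ∘ p)) = 0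
    rw [hc x hx y hy y' hy' z hz, if_neg hne]
  · have ht : x₀⁻¹ * z₀ = x₀⁻¹ * y₁ * y₁⁻¹ * z₀ := by rw [mul_inv_cancel_right]
    show (∑ p : Fin k → Fin n, c p (⇑(x₀⁻¹ * z₀) ∘ p)) ≠ 0
    rw [ht, hc x₀ hx₀ y₁ hy₁ y₁ hy₁ z₀ hz₀, if_pos ⟨rfl, rfl, rfl⟩]
    exact one_ne_zero

/-- **Linear criterion, `Y ≠ ∅` form** (corrected M1): for `X, Y, Z ⊆ 𝔖ₙ` with `Y` non-empty, `(X, Y, Z)` is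
`k`-token separated iff for every target `(x₀, z₀) ∈ X × Z` the evaluation functional `c ↦ Σ_p c p ((x₀⁻¹z₀) ∘ p)`
is not in the `ℂ`-span of the evaluation functionals of the garbage products `x⁻¹ y y'⁻¹ z`,
`¬(x = x₀ ∧ y = y' ∧ z = z₀)`. -/
theorem stub_linearCriterion :
    ∀ (n k : ℕ) (X Y Z : Finset (Equiv.Perm (Fin n))), Y.Nonempty →
      ((∀ x₀ ∈ X, ∀ z₀ ∈ Z, ∃ c : (Fin k → Fin n) → (Fin k → Fin n) → ℂ,
          ∀ x ∈ X, ∀ y ∈ Y, ∀ y' ∈ Y, ∀ z ∈ Z,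
            (∑ p : Fin k → Fin n, c p (⇑(x⁻¹ * y * y'⁻¹ * z) ∘ p)) = if x = x₀ ∧ y = y' ∧ z = z₀ then 1 else 0) ↔
        ∀ x₀ ∈ X, ∀ z₀ ∈ Z,
          (fun c : (Fin k → Fin n) → (Fin k → Fin n) → ℂ => ∑ p : Fin k → Fin n, c p (⇑(x₀⁻¹ * z₀) ∘ p)) ∉
            Submodule.span ℂ
              ((fun g : Equiv.Perm (Fin n) =>
                  fun c : (Fin k → Fin n) → (Fin k → Fin n) → ℂ => ∑ p : Fin k → Fin n, c p (⇑g ∘ p)) ''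
                {g | ∃ x ∈ X, ∃ y ∈ Y, ∃ y' ∈ Y, ∃ z ∈ Z,
                  ¬ (x = x₀ ∧ y = y' ∧ z = z₀) ∧ g = x⁻¹ * y * y'⁻¹ * z})) := by
  intro n k X Y Z hY
  exact ⟨lc_forall_not_mem_span_of_separated hY, lc_separated_of_forall_not_mem_span⟩

/-- **Linear criterion, `n ≥ 1` form** (corrected M1): for `n ≥ 1` and `X, Y, Z ⊆ 𝔖ₙ`, `(X, Y, Z)` is `k`-token
separated iff for every target `(x₀, z₀)` the functional `ev_{x₀⁻¹z₀}` is outside the span of the garbage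
functionals. (`Y ≠ ∅`: `stub_linearCriterion`; `Y = ∅`: both sides hold — separation is vacuous, the
garbage set is empty, and `ev_{x₀⁻¹z₀} ≠ 0` since it is `1` on the indicator table of one `p₀ : Fin k → Fin n`.) -/
theorem linearCriterion_of_pos :
    ∀ (n k : ℕ) (X Y Z : Finset (Equiv.Perm (Fin n))), 0 < n →
      ((∀ x₀ ∈ X, ∀ z₀ ∈ Z, ∃ c : (Fin k → Fin n) → (Fin k → Fin n) → ℂ,
          ∀ x ∈ X, ∀ y ∈ Y, ∀ y' ∈ Y, ∀ z ∈ Z,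
            (∑ p : Fin k → Fin n, c p (⇑(x⁻¹ * y * y'⁻¹ * z) ∘ p)) = if x = x₀ ∧ y = y' ∧ z = z₀ then 1 else 0) ↔
        ∀ x₀ ∈ X, ∀ z₀ ∈ Z,
          (fun c : (Fin k → Fin n) → (Fin k → Fin n) → ℂ => ∑ p : Fin k → Fin n, c p (⇑(x₀⁻¹ * z₀) ∘ p)) ∉
            Submodule.span ℂ
              ((fun g : Equiv.Perm (Fin n) =>
                  fun c : (Fin k → Fin n) → (Fin k → Fin n) → ℂ => ∑ p : Fin k → Fin n, c p (⇑g ∘ p)) ''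
                {g | ∃ x ∈ X, ∃ y ∈ Y, ∃ y' ∈ Y, ∃ z ∈ Z,
                  ¬ (x = x₀ ∧ y = y' ∧ z = z₀) ∧ g = x⁻¹ * y * y'⁻¹ * z})) := by
  intro n k X Y Z hn
  rcases Y.eq_empty_or_nonempty with rfl | hY
  · refine ⟨fun _ _ _ _ _ => ?_, lc_separated_of_forall_not_mem_span⟩
    refine lc_not_mem_span_of_apply
      (fun p _ => if p = (fun _ => (⟨0, hn⟩ : Fin n)) then (1 : ℂ) else 0) ?_ ?_
    · rintro ψ ⟨g, ⟨x, _, y, hy, _⟩, _⟩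
      exact absurd hy (Finset.notMem_empty y)
    · show (∑ p : Fin k → Fin n, if p = (fun _ => (⟨0, hn⟩ : Fin n)) then (1 : ℂ) else 0) ≠ 0
      rw [Finset.sum_ite_eq', if_pos (Finset.mem_univ _)]
      exact one_ne_zero
  · exact stub_linearCriterion n k X Y Z hY

/-- **Linear criterion, hypothesis-free form** (corrected M1): `(X, Y, Z)` is `k`-token separated iff EITHER `Y = ∅`
(separation is then vacuous) OR for every target `(x₀, z₀)` the functional `ev_{x₀⁻¹z₀}` is outside the span of the
garbage functionals — stated as `separated ↔ (Y.Nonempty → criterion)`. -/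
theorem linearCriterion_iff :
    ∀ (n k : ℕ) (X Y Z : Finset (Equiv.Perm (Fin n))),
      (∀ x₀ ∈ X, ∀ z₀ ∈ Z, ∃ c : (Fin k → Fin n) → (Fin k → Fin n) → ℂ,
          ∀ x ∈ X, ∀ y ∈ Y, ∀ y' ∈ Y, ∀ z ∈ Z,
            (∑ p : Fin k → Fin n, c p (⇑(x⁻¹ * y * y'⁻¹ * z) ∘ p)) = if x = x₀ ∧ y = y' ∧ z = z₀ then 1 else 0) ↔
        (Y.Nonempty → ∀ x₀ ∈ X, ∀ z₀ ∈ Z,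
          (fun c : (Fin k → Fin n) → (Fin k → Fin n) → ℂ => ∑ p : Fin k → Fin n, c p (⇑(x₀⁻¹ * z₀) ∘ p)) ∉
            Submodule.span ℂ
              ((fun g : Equiv.Perm (Fin n) =>
                  fun c : (Fin k → Fin n) → (Fin k → Fin n) → ℂ => ∑ p : Fin k → Fin n, c p (⇑g ∘ p)) ''
                {g | ∃ x ∈ X, ∃ y ∈ Y, ∃ y' ∈ Y, ∃ z ∈ Z,
                  ¬ (x = x₀ ∧ y = y' ∧ z = z₀) ∧ g = x⁻¹ * y * y'⁻¹ * z})) := by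
  intro n k X Y Z
  refine ⟨fun h hY => lc_forall_not_mem_span_of_separated hY h, fun h => ?_⟩
  rcases Y.eq_empty_or_nonempty with rfl | hY
  · intro _ _ _ _
    exact ⟨fun _ _ => 0, fun _ _ y hy => absurd hy (Finset.notMem_empty y)⟩
  · exact lc_separated_of_forall_not_mem_span (h hY)

end Summit.MatrixMultiplication.MatrixMultiplication.Theorems.SnLevelDesigns
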